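import Literature.NumberTheory.DiophantineGeometry.KroneckerPointSets
import HarnessLib

/-!
# The simplex embedding of 2D-X-RAY into Kronecker positivity: correctness
# (Brunetti–Del Lungo–Gérard 2001, Thm. 3.1; Fischer–Ikenmeyer 2020, Thm. 5;
# Ikenmeyer–Mulmuley–Walter 2017, Thms. 3.2–3.4)

The mathematical content of the Karp reduction `2D-X-RAY → KRONECKER` by which positivity of
Kronecker coefficients inherits NP-hardness from planar discrete tomography
(`Literature.Computability.Complexity.GGP1999_twoDXRayNPHard`), for the barrier entry
`Literature/Barriers/ValiantsHypothesis/KroneckerPositivityHardness.lean`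
(`IMW2017_kroneckerNPHard`); the string-level map and its running time live in the barrier's
proof file.

**The construction** (BDLG 2001, proof of Thm. 3.1, for permutation instances; FI 2020, Thm. 5,
for arbitrary instances: "Let `μ', ν', ρ' ∈ ℕ^{[0,r]}` be compositions satisfying
`∑ i (μ'_i + ν'_i + ρ'_i) = r|μ'| = r|ν'| = r|ρ'|` (i.e., the corresponding instance is not
trivially unsatisfiable). Let `μ := (μ' + X(Q_{r-1}))ᵀ, ν := (ν' + Y(Q_{r-1}))ᵀ,
ρ := (ρ' + Z(Q_{r-1}))ᵀ` … Then `k(μ, ν, ρ) = …` [the number of solutions]"). Given a 2D-X-RAY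
instance `(μ', ν', ρ')` — prescribed `x`-, `y`-, `z`-marginals for a subset `S` of the grid
`G_r = {x + y + z = r}` (`Tomography.layer r`) — put `X = X(P_r) + μ'`, `Y = Y(P_r) + ν'`,
`Z = Z(P_r) + ρ'` (`liftX`, `liftY`, `liftZ`; `P_r = Tomography.simplex r = FI's Q_{r-1}`) and
let `λ, μ, π ⊢ n = |P_r| + |μ'|` be the partitions with column lengths `X, Y, Z`
(`xrayLam`, `xrayMu`, `xrayPi`, built with `partitionOfRows` and `Nat.Partition.transpose`).

**Proved here.** For ADMISSIBLE instances (`XRayAdmissible`: lengths `r + 1`, equal sums, FI's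
moment identity, and `X, Y, Z` weakly decreasing — all necessary for consistency,
`XRayAdmissible.of_layerSet`):
* `hasMarginals_simplex_union` (⇒): a solution `S ⊆ G_r` gives the point set `P_r ∪ S` with
  marginals `(X, Y, Z) = (λᵀ, μᵀ, πᵀ)`;
* `simplex_subset_of_hasMarginals`, `exists_layerSet_of_hasMarginals` (⇐): a point set with these
  marginals has `|P| = |P_r| + |μ'|` and coordinate sum `B(P_r) + r|μ'|`, so by the exchange lemma
  (`Tomography.simplex_subset_of_card_of_coordSum`) `P_r ⊆ P ⊆ P_{r+1}` and `P ∖ P_r ⊆ G_r`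
  solves the instance (BDLG's condition (1)); in particular every such `P` is a pyramid
  (`isPyramid_of_hasMarginals`);
* `exists_layerSet_iff_pointSetCount_pos`, `exists_layerSet_iff_kroneckerCoeff_pos`: the instance
  is consistent iff `t^λ_{μ,π} > 0` iff `k^λ_{μ,π} = g(λ, μ, π) > 0` (Cor. 2.4 in positivity form,
  `KroneckerPointSets`), over any field of characteristic zero.

Not here: the equality `k(μ, ν, ρ)` = number of solutions (FI Thm. 5 is parsimonious; only
positivity is transported), and anything machine-level.

## References

* [BrunettiDelLungoGerard2001] Linear Algebra Appl. 339 (2001) 59–73, Thm. 3.1 and its proof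
  (held; the instance `X, Y, Z`, "`F = P ∪ …`", condition (1), `G_F = G_A`).
* [FischerIkenmeyer2020] Comput. Complexity 29 (2020) 8 = arXiv:2002.00788 (held), §6 (2D-X-RAY,
  `G_r`), §7 Thm. 5.
* [IkenmeyerMulmuleyWalter2017] arXiv:1507.02955 (held), §3 (Lemma 3.1, Thms. 3.2–3.4).
-/

noncomputable section

open scoped BigOperators

namespace Literature.NumberTheory.DiophantineGeometry

open Literature.Combinatorics.Enumerative.Tomography Finset
open Literature.Computability.Complexity (partitionOfRows getD_sortedParts_partitionOfRows)

/-! ### Lists read as finitely supported vectors -/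

section ListVec

/-- `∑_{i < L} l_i = ∑ l` once `L ≥ |l|` (entries beyond the list are `0`). [folklore] -/
theorem sum_range_getD_eq_sum (l : List ℕ) {L : ℕ} (hL : l.length ≤ L) :
    ∑ i ∈ range L, l.getD i 0 = l.sum := by
  rw [← sum_subset (range_subset_range.2 hL) fun i _ hi =>
    List.getD_eq_default _ _ (not_lt.1 fun h => hi (mem_range.2 h))]
  rw [← Fin.sum_univ_eq_sum_range (fun i => l.getD i 0)]
  have h := Fin.sum_univ_fun_getElem l id
  rw [List.map_id] at h
  refine Eq.trans (sum_congr rfl fun i _ => ?_) h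
  rw [List.getD_eq_getElem _ _ i.2]
  rfl

/-- Weighted version: `∑_{i < L} i · l_i` does not depend on `L ≥ |l|`. [folklore] -/
theorem sum_range_mul_getD_eq (l : List ℕ) {L : ℕ} (hL : l.length ≤ L) :
    ∑ i ∈ range L, i * l.getD i 0 = ∑ i ∈ range l.length, i * l.getD i 0 := by
  rw [← sum_subset (range_subset_range.2 hL) fun i _ hi => ?_]
  rw [List.getD_eq_default _ _ (not_lt.1 fun h => hi (mem_range.2 h)), mul_zero]

end ListVec

/-! ### Marginals of the simplex vanish from `r` on -/

section SimplexMarginals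

/-- The `x`-marginal of `P_r` vanishes from `r` on (coordinates of `P_r` are `< r`). [folklore] -/
theorem xMarginal_simplex_eq_zero {r i : ℕ} (hi : r ≤ i) : xMarginal (simplex r) i = 0 := by
  rw [xMarginal_def, card_eq_zero, filter_eq_empty_iff]
  intro p hp hpi
  have := (lt_of_mem_simplex hp).1
  omega

/-- The `y`-marginal of `P_r` vanishes from `r` on. [folklore] -/
theorem yMarginal_simplex_eq_zero {r j : ℕ} (hj : r ≤ j) : yMarginal (simplex r) j = 0 := by
  rw [yMarginal_def, card_eq_zero, filter_eq_empty_iff]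
  intro p hp hpj
  have := (lt_of_mem_simplex hp).2.1
  omega

/-- The `z`-marginal of `P_r` vanishes from `r` on. [folklore] -/
theorem zMarginal_simplex_eq_zero {r k : ℕ} (hk : r ≤ k) : zMarginal (simplex r) k = 0 := by
  rw [zMarginal_def, card_eq_zero, filter_eq_empty_iff]
  intro p hp hpk
  have := (lt_of_mem_simplex hp).2.2
  omega

end SimplexMarginals

/-! ### The lifted marginals and the admissibility conditions -/

section Lift

/-- The `x`-marginal of the embedded instance: `X = X(P_r) + μ'` (BDLG 2001: `X_i = X_{S₁}P_i + …`;
FI 2020 Thm. 5: `μ' + X(Q_{r-1})`). [cite: FischerIkenmeyer2020, Theorem 5] -/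
def liftX (r : ℕ) (μ' : List ℕ) (i : ℕ) : ℕ := xMarginal (simplex r) i + μ'.getD i 0

/-- The `y`-marginal of the embedded instance: `Y = Y(P_r) + ν'`. [cite: FischerIkenmeyer2020, Theorem 5] -/
def liftY (r : ℕ) (ν' : List ℕ) (j : ℕ) : ℕ := yMarginal (simplex r) j + ν'.getD j 0

/-- The `z`-marginal of the embedded instance: `Z = Z(P_r) + ρ'`. [cite: FischerIkenmeyer2020, Theorem 5] -/
def liftZ (r : ℕ) (ρ' : List ℕ) (k : ℕ) : ℕ := zMarginal (simplex r) k + ρ'.getD k 0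

/-- The size of the embedded instance: `n = |P_r| + |μ'|`. [cite: FischerIkenmeyer2020, Theorem 5] -/
def liftSize (r : ℕ) (μ' : List ℕ) : ℕ := (simplex r).card + μ'.sum

/-- **Admissible 2D-X-RAY instances** `(μ', ν', ρ') ∈ (ℕ^{[0,r]})³`: the vectors have length
`r + 1`, equal sums `|μ'| = |ν'| = |ρ'|`, the first-moment identity
`∑ i (μ'_i + ν'_i + ρ'_i) = r |μ'|` (FI 2020, Thm. 5: "i.e., the corresponding instance is not
trivially unsatisfiable"), and weakly decreasing lifted marginals `X, Y, Z`. All four are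
necessary for consistency (`XRayAdmissible.of_layerSet`); the last makes `X, Y, Z` column-length
vectors of partitions. [cite: FischerIkenmeyer2020, Theorem 5 (hypotheses)] -/
structure XRayAdmissible (r : ℕ) (μ' ν' ρ' : List ℕ) : Prop where
  length₁ : μ'.length = r + 1
  length₂ : ν'.length = r + 1
  length₃ : ρ'.length = r + 1
  sum₂ : ν'.sum = μ'.sum
  sum₃ : ρ'.sum = μ'.sum
  moment : ∑ i ∈ range (r + 1), i * (μ'.getD i 0 + ν'.getD i 0 + ρ'.getD i 0) = r * μ'.sum
  antitoneX : Antitone (liftX r μ')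
  antitoneY : Antitone (liftY r ν')
  antitoneZ : Antitone (liftZ r ρ')

variable {r : ℕ} {μ' ν' ρ' : List ℕ}

/-- `X_i = 0` for `i ≥ r + 1`. [folklore] -/
theorem liftX_eq_zero (h₁ : μ'.length = r + 1) {i : ℕ} (hi : r + 1 ≤ i) : liftX r μ' i = 0 := by
  rw [liftX, xMarginal_simplex_eq_zero (by omega), List.getD_eq_default _ _ (by omega)]

/-- `Y_j = 0` for `j ≥ r + 1`. [folklore] -/
theorem liftY_eq_zero (h₂ : ν'.length = r + 1) {j : ℕ} (hj : r + 1 ≤ j) : liftY r ν' j = 0 := by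
  rw [liftY, yMarginal_simplex_eq_zero (by omega), List.getD_eq_default _ _ (by omega)]

/-- `Z_k = 0` for `k ≥ r + 1`. [folklore] -/
theorem liftZ_eq_zero (h₃ : ρ'.length = r + 1) {k : ℕ} (hk : r + 1 ≤ k) : liftZ r ρ' k = 0 := by
  rw [liftZ, zMarginal_simplex_eq_zero (by omega), List.getD_eq_default _ _ (by omega)]

/-- `∑_{i < L} X_i = n` for `L ≥ r + 1`. [folklore] -/
theorem sum_liftX (h₁ : μ'.length = r + 1) {L : ℕ} (hL : r + 1 ≤ L) :
    ∑ i ∈ range L, liftX r μ' i = liftSize r μ' := by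
  simp only [liftX, sum_add_distrib, liftSize]
  rw [← card_eq_sum_xMarginal fun p hp => lt_of_lt_of_le (lt_of_mem_simplex hp).1 (by omega),
    sum_range_getD_eq_sum μ' (by omega)]

/-- `∑_{j < L} Y_j = n` for `L ≥ r + 1` (using `|ν'| = |μ'|`). [folklore] -/
theorem sum_liftY (h : XRayAdmissible r μ' ν' ρ') {L : ℕ} (hL : r + 1 ≤ L) :
    ∑ j ∈ range L, liftY r ν' j = liftSize r μ' := by
  simp only [liftY, sum_add_distrib, liftSize]
  rw [← card_eq_sum_yMarginal fun p hp => lt_of_lt_of_le (lt_of_mem_simplex hp).2.1 (by omega),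
    sum_range_getD_eq_sum ν' (by rw [h.length₂]; omega), h.sum₂]

/-- `∑_{k < L} Z_k = n` for `L ≥ r + 1` (using `|ρ'| = |μ'|`). [folklore] -/
theorem sum_liftZ (h : XRayAdmissible r μ' ν' ρ') {L : ℕ} (hL : r + 1 ≤ L) :
    ∑ k ∈ range L, liftZ r ρ' k = liftSize r μ' := by
  simp only [liftZ, sum_add_distrib, liftSize]
  rw [← card_eq_sum_zMarginal fun p hp => lt_of_lt_of_le (lt_of_mem_simplex hp).2.2 (by omega),
    sum_range_getD_eq_sum ρ' (by rw [h.length₃]; omega), h.sum₃]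

/-! ### The three partitions `(λ, μ, π)` with column lengths `X, Y, Z` -/

/-- **The Kronecker instance of an admissible 2D-X-RAY instance**, first partition: `λ` with
`λᵀ = X = X(P_r) + μ'` (FI 2020 Thm. 5: `μ := (μ' + X(Q_{r-1}))ᵀ`; BDLG 2001, the instance
`X, Y, Z` of Thm. 3.1). [cite: FischerIkenmeyer2020, Theorem 5] -/
def xrayLam (r : ℕ) (μ' : List ℕ) : Nat.Partition (liftSize r μ') :=
  (partitionOfRows (liftX r μ') (r + 1) (liftSize r μ')).transpose

/-- Second partition: `μ` with `μᵀ = Y = Y(P_r) + ν'` (a partition of the same `n`, using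
`|ν'| = |μ'|`). [cite: FischerIkenmeyer2020, Theorem 5] -/
def xrayMu (r : ℕ) (μ' ν' : List ℕ) : Nat.Partition (liftSize r μ') :=
  (partitionOfRows (liftY r ν') (r + 1) (liftSize r μ')).transpose

/-- Third partition: `π` with `πᵀ = Z = Z(P_r) + ρ'`. [cite: FischerIkenmeyer2020, Theorem 5] -/
def xrayPi (r : ℕ) (μ' ρ' : List ℕ) : Nat.Partition (liftSize r μ') :=
  (partitionOfRows (liftZ r ρ') (r + 1) (liftSize r μ')).transpose

/-- `λᵀ = X`: the column lengths of `xrayLam` are the lifted `x`-marginal. [cite: FischerIkenmeyer2020, Theorem 5] -/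
theorem colLen_xrayLam (h : XRayAdmissible r μ' ν' ρ') (i : ℕ) :
    (xrayLam r μ').youngDiagram.colLen i = liftX r μ' i := by
  rw [← getD_sortedParts_transpose, xrayLam, Nat.Partition.transpose_transpose,
    getD_sortedParts_partitionOfRows h.antitoneX (sum_liftX h.length₁ le_rfl)]
  split_ifs with hi
  · rfl
  · exact (liftX_eq_zero h.length₁ (not_lt.1 hi)).symm

/-- `μᵀ = Y`. [cite: FischerIkenmeyer2020, Theorem 5] -/
theorem colLen_xrayMu (h : XRayAdmissible r μ' ν' ρ') (j : ℕ) :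
    (xrayMu r μ' ν').youngDiagram.colLen j = liftY r ν' j := by
  rw [← getD_sortedParts_transpose, xrayMu, Nat.Partition.transpose_transpose,
    getD_sortedParts_partitionOfRows h.antitoneY (sum_liftY h le_rfl)]
  split_ifs with hj
  · rfl
  · exact (liftY_eq_zero h.length₂ (not_lt.1 hj)).symm

/-- `πᵀ = Z`. [cite: FischerIkenmeyer2020, Theorem 5] -/
theorem colLen_xrayPi (h : XRayAdmissible r μ' ν' ρ') (k : ℕ) :
    (xrayPi r μ' ρ').youngDiagram.colLen k = liftZ r ρ' k := by
  rw [← getD_sortedParts_transpose, xrayPi, Nat.Partition.transpose_transpose,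
    getD_sortedParts_partitionOfRows h.antitoneZ (sum_liftZ h le_rfl)]
  split_ifs with hk
  · rfl
  · exact (liftZ_eq_zero h.length₃ (not_lt.1 hk)).symm

/-! ### Correctness of the embedding -/

/-- **Soundness**: a solution `S ⊆ G_r` of the 2D-X-RAY instance gives the point set `P_r ∪ S`
with marginals `(X, Y, Z) = (λᵀ, μᵀ, πᵀ)` (BDLG 2001, proof of Thm. 3.1: "`F = P ∪ {…}` verifies
`X_{S₁}F = X, X_{S₂}F = Y and X_{S₃}F = Z`"). [cite: BrunettiDelLungoGerard2001, Thm. 3.1 (proof, ⇒)] -/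
theorem hasMarginals_simplex_union (h : XRayAdmissible r μ' ν' ρ') {S : Finset Point3}
    (hS : S ⊆ layer r) (hx : ∀ i, xMarginal S i = μ'.getD i 0)
    (hy : ∀ j, yMarginal S j = ν'.getD j 0) (hz : ∀ k, zMarginal S k = ρ'.getD k 0) :
    HasMarginals (simplex r ∪ S) (xrayLam r μ') (xrayMu r μ' ν') (xrayPi r μ' ρ') := by
  have hd : Disjoint (simplex r) S :=
    disjoint_of_subset_right hS (disjoint_simplex_layer r)
  refine ⟨fun i => ?_, fun j => ?_, fun k => ?_⟩
  · rw [xMarginal_union hd, colLen_xrayLam h, liftX, hx]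
  · rw [yMarginal_union hd, colLen_xrayMu h, liftY, hy]
  · rw [zMarginal_union hd, colLen_xrayPi h, liftZ, hz]

/-- The coordinate sum of a point set with marginals `(X, Y, Z)` is `B(P_r) + r |μ'|`
(BDLG 2001, proof of Thm. 3.1: the barycentre computation `G_F = G_A`; FI 2020 Thm. 5's moment
hypothesis). [cite: BrunettiDelLungoGerard2001, Thm. 3.1 (proof, barycentre)] -/
theorem coordSum_of_hasMarginals (h : XRayAdmissible r μ' ν' ρ') {P : Finset Point3}
    (hP : HasMarginals P (xrayLam r μ') (xrayMu r μ' ν') (xrayPi r μ' ρ')) :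
    coordSum P = coordSum (simplex r) + r * μ'.sum := by
  set N := liftSize r μ' + (r + 1) with hN
  have hsub := hP.subset_box
  have hbound : ∀ p ∈ P, p.1 < N ∧ p.2.1 < N ∧ p.2.2 < N := fun p hp => by
    have h1 := mem_product.1 (hsub hp)
    have h2 := mem_product.1 h1.2
    have := mem_range.1 h1.1; have := mem_range.1 h2.1; have := mem_range.1 h2.2
    refine ⟨?_, ?_, ?_⟩ <;> omega
  have hsbound : ∀ p ∈ simplex r, p.1 < N ∧ p.2.1 < N ∧ p.2.2 < N := fun p hp => by
    obtain ⟨a, b, c⟩ := lt_of_mem_simplex hp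
    refine ⟨?_, ?_, ?_⟩ <;> omega
  obtain ⟨hx, hy, hz⟩ := hP
  rw [coordSum_eq_sum_marginals hbound, coordSum_eq_sum_marginals hsbound]
  simp_rw [hx, hy, hz, colLen_xrayLam h, colLen_xrayMu h, colLen_xrayPi h, liftX, liftY, liftZ,
    mul_add, sum_add_distrib]
  have hrN : r + 1 ≤ N := by omega
  rw [sum_range_mul_getD_eq μ' (by rw [h.length₁]; exact hrN),
    sum_range_mul_getD_eq ν' (by rw [h.length₂]; exact hrN),
    sum_range_mul_getD_eq ρ' (by rw [h.length₃]; exact hrN), h.length₁, h.length₂, h.length₃]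
  have hm := h.moment
  simp_rw [mul_add, sum_add_distrib] at hm
  omega

/-- **Completeness**: every point set with marginals `(X, Y, Z)` is sandwiched,
`P_r ⊆ P ⊆ P_{r+1}` (the exchange lemma, `Tomography.simplex_subset_of_card_of_coordSum`), hence
`S = P ∖ P_r ⊆ G_r` solves the 2D-X-RAY instance (BDLG 2001, proof of Thm. 3.1, condition (1):
"the set `F` is the union of `P` with a set `H`"). [cite: BrunettiDelLungoGerard2001, Thm. 3.1 (proof, ⇐)] -/
theorem simplex_subset_of_hasMarginals (h : XRayAdmissible r μ' ν' ρ') {P : Finset Point3}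
    (hP : HasMarginals P (xrayLam r μ') (xrayMu r μ' ν') (xrayPi r μ' ρ')) :
    simplex r ⊆ P ∧ P ⊆ simplex (r + 1) :=
  simplex_subset_of_card_of_coordSum (m := μ'.sum) hP.card_eq (coordSum_of_hasMarginals h hP)

/-- **Completeness, continued**: the top layer `P ∖ P_r` of such a point set solves the
2D-X-RAY instance. [cite: BrunettiDelLungoGerard2001, Thm. 3.1 (proof, ⇐)] -/
theorem exists_layerSet_of_hasMarginals (h : XRayAdmissible r μ' ν' ρ') {P : Finset Point3}
    (hP : HasMarginals P (xrayLam r μ') (xrayMu r μ' ν') (xrayPi r μ' ρ')) :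
    ∃ S : Finset Point3, S ⊆ layer r ∧ (∀ i, xMarginal S i = μ'.getD i 0) ∧
      (∀ j, yMarginal S j = ν'.getD j 0) ∧ (∀ k, zMarginal S k = ρ'.getD k 0) := by
  obtain ⟨h₁, h₂⟩ := simplex_subset_of_hasMarginals h hP
  obtain ⟨hS, hx, hy, hz⟩ := marginals_of_simplex_subset h₁ h₂
  obtain ⟨hPx, hPy, hPz⟩ := hP
  refine ⟨P \ simplex r, hS, fun i => ?_, fun j => ?_, fun k => ?_⟩
  · have e := hx i
    rw [hPx, colLen_xrayLam h, liftX] at e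
    omega
  · have e := hy j
    rw [hPy, colLen_xrayMu h, liftY] at e
    omega
  · have e := hz k
    rw [hPz, colLen_xrayPi h, liftZ] at e
    omega

/-- Every point set with marginals `(X, Y, Z)` is a pyramid (sandwiched sets are pyramids,
`Tomography.isPyramid_of_simplex_subset`; IMW Lemma 3.1). [cite: IkenmeyerMulmuleyWalter2017, Lemma 3.1] -/
theorem isPyramid_of_hasMarginals (h : XRayAdmissible r μ' ν' ρ') {P : Finset Point3}
    (hP : HasMarginals P (xrayLam r μ') (xrayMu r μ' ν') (xrayPi r μ' ρ')) : IsPyramid P := by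
  obtain ⟨h₁, h₂⟩ := simplex_subset_of_hasMarginals h hP
  exact isPyramid_of_simplex_subset h₁ h₂

/-- **The embedding is a reduction (positivity form of FI 2020 Thm. 5 / BDLG 2001 Thm. 3.1)**:
an admissible 2D-X-RAY instance has a solution in the grid `G_r` iff `t^λ_{μ,π} > 0` for its
Kronecker instance. [cite: FischerIkenmeyer2020, Theorem 5] -/
theorem exists_layerSet_iff_pointSetCount_pos (h : XRayAdmissible r μ' ν' ρ') :
    (∃ S : Finset Point3, S ⊆ layer r ∧ (∀ i, xMarginal S i = μ'.getD i 0) ∧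
      (∀ j, yMarginal S j = ν'.getD j 0) ∧ (∀ k, zMarginal S k = ρ'.getD k 0)) ↔
      0 < pointSetCount (xrayLam r μ') (xrayMu r μ' ν') (xrayPi r μ' ρ') := by
  rw [pointSetCount_pos_iff]
  constructor
  · rintro ⟨S, hS, hx, hy, hz⟩
    exact ⟨_, hasMarginals_simplex_union h hS hx hy hz⟩
  · rintro ⟨P, hP⟩
    exact exists_layerSet_of_hasMarginals h hP

/-- … iff the Kronecker coefficient `k^λ_{μ,π} = g(λ, μ, π)` is positive (any field of
characteristic zero): Cor. 2.4 in positivity form, all compatible point sets being pyramids.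
[cite: IkenmeyerMulmuleyWalter2017, Theorem 3.4 (proof)] -/
theorem exists_layerSet_iff_kroneckerCoeff_pos (k : Type*) [Field k] [CharZero k]
    (h : XRayAdmissible r μ' ν' ρ') :
    (∃ S : Finset Point3, S ⊆ layer r ∧ (∀ i, xMarginal S i = μ'.getD i 0) ∧
      (∀ j, yMarginal S j = ν'.getD j 0) ∧ (∀ k, zMarginal S k = ρ'.getD k 0)) ↔
      0 < kroneckerCoeff k (xrayLam r μ') (xrayMu r μ' ν') (xrayPi r μ' ρ') := by
  rw [exists_layerSet_iff_pointSetCount_pos h,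
    kroneckerCoeff_pos_iff_pointSetCount_pos_of_forall_isPyramid k fun _ hP =>
      isPyramid_of_hasMarginals h hP]

/-! ### Necessity of admissibility -/

/-- **Consistent instances are admissible**: if some `S ⊆ G_r` has marginals `(μ', ν', ρ')`
(vectors of length `r + 1`) then the sums agree (`|S|` three times), the first moment is
`∑_{p ∈ S} (x+y+z) = r |S|`, and `X, Y, Z` are the marginals of the pyramid `P_r ∪ S`, hence
weakly decreasing. [cite: FischerIkenmeyer2020, Theorem 5 (hypotheses)] -/
theorem XRayAdmissible.of_layerSet (h₁ : μ'.length = r + 1) (h₂ : ν'.length = r + 1)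
    (h₃ : ρ'.length = r + 1) {S : Finset Point3} (hS : S ⊆ layer r)
    (hx : ∀ i, xMarginal S i = μ'.getD i 0) (hy : ∀ j, yMarginal S j = ν'.getD j 0)
    (hz : ∀ k, zMarginal S k = ρ'.getD k 0) : XRayAdmissible r μ' ν' ρ' := by
  have hcoord : ∀ p ∈ S, p.1 < r + 1 ∧ p.2.1 < r + 1 ∧ p.2.2 < r + 1 := fun p hp => by
    have := mem_layer.1 (hS hp)
    unfold csum at this
    refine ⟨?_, ?_, ?_⟩ <;> omega
  have hcx : S.card = μ'.sum := by
    rw [card_eq_sum_xMarginal fun p hp => (hcoord p hp).1, ← sum_range_getD_eq_sum μ' h₁.le]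
    exact sum_congr rfl fun i _ => hx i
  have hcy : S.card = ν'.sum := by
    rw [card_eq_sum_yMarginal fun p hp => (hcoord p hp).2.1, ← sum_range_getD_eq_sum ν' h₂.le]
    exact sum_congr rfl fun j _ => hy j
  have hcz : S.card = ρ'.sum := by
    rw [card_eq_sum_zMarginal fun p hp => (hcoord p hp).2.2, ← sum_range_getD_eq_sum ρ' h₃.le]
    exact sum_congr rfl fun k _ => hz k
  -- the pyramid `P_r ∪ S`
  have hd : Disjoint (simplex r) S := disjoint_of_subset_right hS (disjoint_simplex_layer r)
  have hpyr : IsPyramid (simplex r ∪ S) :=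
    isPyramid_of_simplex_subset subset_union_left
      (union_subset (simplex_subset_succ r) (hS.trans (layer_subset_simplex_succ r)))
  refine ⟨h₁, h₂, h₃, hcy.symm.trans hcx, hcz.symm.trans hcx, ?_, ?_, ?_, ?_⟩
  · -- the moment: `B(S) = r |S|`
    have hB : coordSum S = r * S.card := by
      unfold coordSum
      rw [mul_comm, sum_const_nat fun p hp => mem_layer.1 (hS hp)]
    rw [coordSum_eq_sum_marginals hcoord] at hB
    simp_rw [hx, hy, hz] at hB
    rw [hcx] at hB
    simp_rw [mul_add, sum_add_distrib]
    exact hB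
  · refine antitone_nat_of_succ_le fun i => ?_
    have := hpyr.xMarginal_succ_le i
    rwa [xMarginal_union hd, xMarginal_union hd, hx, hx] at this
  · refine antitone_nat_of_succ_le fun j => ?_
    have := hpyr.yMarginal_succ_le j
    rwa [yMarginal_union hd, yMarginal_union hd, hy, hy] at this
  · refine antitone_nat_of_succ_le fun k => ?_
    have := hpyr.zMarginal_succ_le k
    rwa [zMarginal_union hd, zMarginal_union hd, hz, hz] at this

end Lift

end Literature.NumberTheory.DiophantineGeometry
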